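import Literature.NumberTheory.Connes2026.AnnulusScalingSupport
import Literature.NumberTheory.Connes2026.AnnulusCorrectionExpansion
import Literature.NumberTheory.Connes2026.SemilocalCutoffTraceReduction
import Literature.Analysis.OperatorTheory.HilbertSchmidtPairing
import HarnessLib

/-!
# Connes 1999 Thm VII.4, `k = ℚ`, `S = {∞} ∪ P` — SCALE INVARIANCE OF THE ANNULUS PIECES:
# `ϑ(g) P̂⁰_L Q_{a,b} = ϑ(Λ) (ϑ(g) P̂⁰_{LΛ} Q_{a/Λ, b/Λ}) ϑ(Λ)⁻¹`, Hilbert bases of `L²(ℝ)_ev` transported by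
# `ϑ(Λ)`, and the Hilbert–Schmidt data of `ϑ(g) Q_{a,b}` along Hilbert bases of `L²(ℝ)_ev`

LABEL (line 1): RH-FREE literature (theorems + two auxiliary `def`s — a restricted unitary and a transported
Hilbert basis; NO named fact).  bears_on: LADDER-RH W-C/W-P (C1 named-fact debt), cell `rh-crit`, sub-cell
cc, overflow row O1 — green layer under the row's last named fact `Connes1999_thm_VII_4_rat` (the cases
`P ≠ ∅`), sixth file of the "annulus road" (`SemilocalCutoffConjugation`, `AnnulusScalingSupport`,
`SemilocalCutoffTraceReduction`, `AnnulusCorrectionExpansion`, `SemilocalCutoffLimits`; toolkit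
`Analysis/OperatorTheory/HilbertSchmidtPairing`).  WHAT THIS IS NOT: any claim about positivity, Weil's
criterion or RH; nothing here bears on the truth of RH.

Sources.  A. Connes, Selecta Math. 5 (1999) [`Connes1999`], §V (15)–(16) (scale covariance of the cutoffs),
§VII (12)–(13), Thm VII.4 and its proof (29)–(33) (held text `paper:arxiv-math_9811068`, p0013); A. Connes,
C. Consani, Selecta Math. 27 (2021) 77 [`ConnesConsani2021`], §4 eq. (40) (`ϑ` acts on `L²(ℝ)_ev`);
M. Reed, B. Simon, *Methods of Modern Mathematical Physics I* (1972) [`ReedSimon1972`], Thm. VI.18, VI.22.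

## What is proved

With `ϑ_τ = scalingUnitary τ` (`ϑ(e^τ)`), `P_Λ = cutoffProj Λ`, `P̂⁰_L = dualCutoffProj ∅ L`,
`Q_{a,b} = shellProj a b = P_b − P_a`, `Q₀(Λ) = annulusProj p Λ = Q_{Λ/p, Λ}`:

* §1 `scalingUnitary_mul_neg`, `commute_scalingUnitary_scalingOp`, **`cutoffProj_eq_conj`**
  (`P_Λ = ϑ_τ P_{Λe^{−τ}} ϑ_{−τ}`), **`dualCutoffProj_empty_eq_conj`** (`P̂⁰_L = ϑ_τ P̂⁰_{Le^{τ}} ϑ_{−τ}`),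
  `shellProj_eq_conj`, and **`scalingOp_dualCutoffProj_shellProj_eq_conj`**:
  `ϑ(g) P̂⁰_L Q_{a,b} = ϑ_τ (ϑ(g) P̂⁰_{Le^τ} Q_{ae^{−τ}, be^{−τ}}) ϑ_{−τ}`; at `τ = log Λ`:
  **`scalingOp_dualCutoffProj_annulusProj_eq_conj`** —
  `ϑ(g) P̂⁰_L Q₀(Λ) = ϑ_{log Λ} (ϑ(g) P̂⁰_{LΛ} Q₀(1)) ϑ_{−log Λ}`: the annulus pieces of the cutoff trace at
  scale `Λ` are unitarily conjugate to pieces with the FIXED annulus `Q₀(1) = Q_{1/p, 1}` and the ultraviolet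
  cutoff pushed to `LΛ → ∞` (Connes 1999 (29): only the product of the two cutoff scales matters);
* §2 `scalingUnitaryEven τ : evenPart ≃ₗᵢ[ℂ] evenPart` (restriction of `ϑ_τ`), `HilbertBasis.scalingConj`
  (`(b.scalingConj τ) i = ϑ_{−τ} (b i)`), and **`diagSeries_conj_scalingUnitary`**: for every bounded `X`,
  `⟨b_i, ϑ_τ X ϑ_{−τ} b_i⟩ = ⟨b'_i, X b'_i⟩` termwise with `b' = b.scalingConj τ` — so summability and sums
  of diagonal series over Hilbert bases of `L²(ℝ)_ev` are unchanged by the conjugation of §1;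
* §3 (generic, `Literature.Analysis.OperatorTheory`) `summable_norm_sq_apply_of_mem_of_summable` — if
  `Σ_i ‖T e_i‖²` converges along a Hilbert basis of `E` then `Σ_j ‖T b_j‖²` converges along every Hilbert
  basis of every closed subspace, with the smaller sum (Reed–Simon VI.18); and for `L²(ℝ)_ev`:
  **`summable_norm_sq_scalingOp_shellProj_of_mem`**, **`summable_norm_sq_adjoint_scalingOp_shellProj_of_mem`**
  — for `g ∈ C_c(ℝ)`, `0 < a ≤ b`, the operators `ϑ(g) Q_{a,b}` and `(ϑ(g) Q_{a,b})†` are Hilbert–Schmidt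
  along every Hilbert basis of `L²(ℝ)_ev` (from `hasSum_norm_sq_scalingOp_shellProj`): the Hilbert–Schmidt
  DATA that the pairing toolkit and the Tannery step of `SemilocalCutoffLimits` consume.

No instance, notation or attribute.
-/

noncomputable section

open _root_.MeasureTheory Complex Set Filter
open scoped Real Topology ComplexConjugate ENNReal InnerProductSpace

/-! ## §3 (generic part). Hilbert–Schmidt sums restricted to a closed subspace -/

namespace Literature.Analysis.OperatorTheory

variable {𝕜 : Type*} [RCLike 𝕜]
variable {E F : Type*} [NormedAddCommGroup E] [InnerProductSpace 𝕜 E] [CompleteSpace E]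
  [NormedAddCommGroup F] [InnerProductSpace 𝕜 F] [CompleteSpace F]

/-- **A Hilbert–Schmidt operator is Hilbert–Schmidt on every closed subspace**: if `Σ_i ‖T e_i‖²` converges
along a Hilbert basis `(e_i)` of `E`, then along every Hilbert basis `(b_j)` of a closed subspace `V` the sum
`Σ_j ‖T b_j‖²` converges and is at most `Σ_i ‖T e_i‖²` (orthonormal partial sums are bounded by the trace,
Reed–Simon I Thm. VI.18). [cite: ReedSimon1972, Thm. VI.18, PDF p. 196] -/
theorem summable_norm_sq_apply_of_mem_of_summable {ι κ : Type*} {V : Submodule 𝕜 E} [CompleteSpace V]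
    (b : HilbertBasis ι 𝕜 E) (bV : HilbertBasis κ 𝕜 V) (T : E →L[𝕜] F)
    (hT : Summable fun i => ‖T (b i)‖ ^ 2) :
    Summable (fun j => ‖T (bV j : E)‖ ^ 2) ∧ ∑' j, ‖T (bV j : E)‖ ^ 2 ≤ ∑' i, ‖T (b i)‖ ^ 2 := by
  have hv : Orthonormal 𝕜 (fun j => (bV j : E)) := (V.subtypeₗᵢ.orthonormal_comp_iff).mpr bV.orthonormal
  have hS0 : 0 ≤ ∑' i, ‖T (b i)‖ ^ 2 := tsum_nonneg fun _ => sq_nonneg _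
  have henorm : ∀ x : F, ‖x‖ₑ ^ 2 = ENNReal.ofReal (‖x‖ ^ 2) := fun x => by
    rw [← ofReal_norm, ENNReal.ofReal_pow (norm_nonneg _)]
  have htot : ∑' i, ‖T (b i)‖ₑ ^ 2 = ENNReal.ofReal (∑' i, ‖T (b i)‖ ^ 2) := by
    simp_rw [henorm]
    exact (ENNReal.ofReal_tsum_of_nonneg (fun _ => sq_nonneg _) hT).symm
  have hfin : ∀ s : Finset κ, ∑ j ∈ s, ‖T (bV j : E)‖ ^ 2 ≤ ∑' i, ‖T (b i)‖ ^ 2 := fun s => by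
    have h := sum_enorm_sq_apply_le_tsum b T hv s
    rw [htot] at h
    simp_rw [henorm] at h
    rw [← ENNReal.ofReal_sum_of_nonneg (fun _ _ => sq_nonneg _)] at h
    exact (ENNReal.ofReal_le_ofReal_iff hS0).mp h
  have hsum : Summable fun j => ‖T (bV j : E)‖ ^ 2 := summable_of_sum_le (fun _ => sq_nonneg _) hfin
  exact ⟨hsum, hasSum_le_of_sum_le hsum.hasSum hfin⟩

end Literature.Analysis.OperatorTheory

namespace Literature.NumberTheory.Connes2026

open Literature.NumberTheory.LFunctions Literature.Analysis.OperatorTheory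
open Literature.NumberTheory.ConnesConsani
open Literature.NumberTheory.ConnesConsani2024
open Literature.NumberTheory.ConnesConsani2021 hiding cutoffProj cutoffProj_coeFn

/-! ## §1. Scale conjugation of the cutoffs and of the annulus pieces -/

section Conj

/-- `ϑ_τ ϑ_{−τ} = 1`. [cite: ConnesConsani2021, §4 eq. (40) p. 15] -/
theorem scalingUnitary_mul_neg (τ : ℝ) : scalingUnitary τ * scalingUnitary (-τ) = 1 := by
  rw [ContinuousLinearMap.mul_def, ← scalingUnitary_add, add_neg_cancel, scalingUnitary_zero]

/-- `ϑ_{−τ} ϑ_τ = 1`. [cite: ConnesConsani2021, §4 eq. (40) p. 15] -/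
theorem scalingUnitary_neg_mul (τ : ℝ) : scalingUnitary (-τ) * scalingUnitary τ = 1 := by
  rw [ContinuousLinearMap.mul_def, ← scalingUnitary_add, neg_add_cancel, scalingUnitary_zero]

/-- `ϑ_τ` commutes with `ϑ(g)` (the scaling group is commutative). [cite: ConnesConsani2021, §4 eq. (40) p. 15] -/
theorem commute_scalingUnitary_scalingOp (τ : ℝ) (g : ℝ → ℂ) : Commute (scalingUnitary τ) (scalingOp g) :=
  (commute_lpDilation_scalingOp (Real.exp_pos (-τ)).ne' g).smul_left _

/-- **`P_Λ = ϑ_τ P_{Λe^{−τ}} ϑ_{−τ}`.** [cite: Connes1999, §V eqs. (15)–(16), §VII eq. (12) (arXiv p0013)] -/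
theorem cutoffProj_eq_conj (Λ τ : ℝ) :
    cutoffProj Λ = scalingUnitary τ * cutoffProj (Λ * Real.exp (-τ)) * scalingUnitary (-τ) := by
  rw [← cutoffProj_mul_scalingUnitary, mul_assoc, scalingUnitary_mul_neg, mul_one]

/-- **`P̂⁰_L = ϑ_τ P̂⁰_{Le^{τ}} ϑ_{−τ}`.** [cite: Connes1999, §V eqs. (15)–(16), §VII eq. (13) (arXiv p0013)] -/
theorem dualCutoffProj_empty_eq_conj (L τ : ℝ) :
    dualCutoffProj ∅ L = scalingUnitary τ * dualCutoffProj ∅ (L * Real.exp τ) * scalingUnitary (-τ) := by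
  rw [← dualCutoffProj_empty_mul_scalingUnitary, mul_assoc, scalingUnitary_mul_neg, mul_one]

/-- `Q_{a,b} = ϑ_τ Q_{ae^{−τ}, be^{−τ}} ϑ_{−τ}`. [cite: Connes1999, §V eqs. (15)–(16), §VII eq. (12) (arXiv p0013)] -/
theorem shellProj_eq_conj (a b τ : ℝ) :
    shellProj a b = scalingUnitary τ * shellProj (a * Real.exp (-τ)) (b * Real.exp (-τ)) * scalingUnitary (-τ) := by
  rw [shellProj_def, shellProj_def, mul_sub, sub_mul, ← cutoffProj_eq_conj, ← cutoffProj_eq_conj]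

/-- **`ϑ(g) P̂⁰_L Q_{a,b} = ϑ_τ (ϑ(g) P̂⁰_{Le^τ} Q_{ae^{−τ}, be^{−τ}}) ϑ_{−τ}`** — the infrared and ultraviolet
scales move oppositely, `ϑ(g)` is invariant. [cite: Connes1999, §VII proof of Thm 4 eq. (29) (arXiv p0013)] -/
theorem scalingOp_dualCutoffProj_shellProj_eq_conj (g : ℝ → ℂ) (L a b τ : ℝ) :
    scalingOp g * dualCutoffProj ∅ L * shellProj a b =
      scalingUnitary τ * (scalingOp g * dualCutoffProj ∅ (L * Real.exp τ) *
        shellProj (a * Real.exp (-τ)) (b * Real.exp (-τ))) * scalingUnitary (-τ) := by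
  have hc := (commute_scalingUnitary_scalingOp τ g).eq
  rw [shellProj_eq_conj a b τ, dualCutoffProj_empty_eq_conj L τ]
  calc scalingOp g * (scalingUnitary τ * dualCutoffProj ∅ (L * Real.exp τ) * scalingUnitary (-τ)) *
        (scalingUnitary τ * shellProj (a * Real.exp (-τ)) (b * Real.exp (-τ)) * scalingUnitary (-τ))
      = (scalingOp g * scalingUnitary τ) * dualCutoffProj ∅ (L * Real.exp τ) *
          (scalingUnitary (-τ) * scalingUnitary τ) * shellProj (a * Real.exp (-τ)) (b * Real.exp (-τ)) *
          scalingUnitary (-τ) := by simp only [mul_assoc]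
    _ = scalingUnitary τ * (scalingOp g * dualCutoffProj ∅ (L * Real.exp τ) *
          shellProj (a * Real.exp (-τ)) (b * Real.exp (-τ))) * scalingUnitary (-τ) := by
        rw [scalingUnitary_neg_mul, mul_one, ← hc]; simp only [mul_assoc]

/-- **At `τ = log Λ`: `ϑ(g) P̂⁰_L Q₀(Λ) = ϑ_{log Λ} (ϑ(g) P̂⁰_{LΛ} Q₀(1)) ϑ_{−log Λ}`** with the FIXED annulus
`Q₀(1) = Q_{1/p, 1}` — the cutoff-trace pieces at scale `Λ` are unitarily conjugate to pieces whose only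
`Λ`-dependence is the ultraviolet cutoff `P̂⁰_{LΛ} → 1`. [cite: Connes1999, §VII proof of Thm 4 eqs. (29)–(33) (arXiv p0013)] -/
theorem scalingOp_dualCutoffProj_annulusProj_eq_conj (g : ℝ → ℂ) (p : ℕ) (L : ℝ) {Λ : ℝ} (hΛ : 0 < Λ) :
    scalingOp g * dualCutoffProj ∅ L * annulusProj p Λ =
      scalingUnitary (Real.log Λ) * (scalingOp g * dualCutoffProj ∅ (L * Λ) * annulusProj p 1) *
        scalingUnitary (-Real.log Λ) := by
  rw [annulusProj_eq_shellProj, annulusProj_eq_shellProj,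
    scalingOp_dualCutoffProj_shellProj_eq_conj g L (Λ / p) Λ (Real.log Λ), Real.exp_log hΛ,
    Real.exp_neg, Real.exp_log hΛ, mul_inv_cancel₀ hΛ.ne', div_mul_eq_mul_div, mul_inv_cancel₀ hΛ.ne']

end Conj

/-! ## §2. Hilbert bases of `L²(ℝ)_ev` transported by `ϑ_τ` -/

section Even

/-- `ϑ_τ` preserves `L²(ℝ)_ev` (`ϑ_τ = e^{−τ/2} D_{e^{−τ}}` and dilations preserve parity). [cite: ConnesConsani2021, §4 eq. (40) p. 15 ("ϑ acts on L²(ℝ)_ev")] -/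
theorem scalingUnitary_apply_mem_evenPart (τ : ℝ) {ξ : Lp ℂ 2 (volume : Measure ℝ)} (hξ : ξ ∈ evenPart) :
    scalingUnitary τ ξ ∈ evenPart := by
  rw [scalingUnitary_apply]
  exact Submodule.smul_mem _ _ (lpDilation_mem_evenPart _ hξ)

/-- `L²(ℝ)_ev` is complete (a closed subspace). [cite: ConnesConsani2021, §4 p. 15] -/
theorem completeSpace_evenPart : CompleteSpace (evenPart : Submodule ℂ (Lp ℂ 2 (volume : Measure ℝ))) :=
  isClosed_evenPart.completeSpace_coe

/-- **The restriction of `ϑ_τ` to `L²(ℝ)_ev` as a unitary of `evenPart`** (inverse: the restriction of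
`ϑ_{−τ}`). [cite: ConnesConsani2021, §4 eq. (40) p. 15 ("ϑ acts on L²(ℝ)_ev")] -/
def scalingUnitaryEven (τ : ℝ) : evenPart ≃ₗᵢ[ℂ] (evenPart : Submodule ℂ (Lp ℂ 2 (volume : Measure ℝ))) where
  toFun x := ⟨scalingUnitary τ x, scalingUnitary_apply_mem_evenPart τ x.2⟩
  invFun x := ⟨scalingUnitary (-τ) x, scalingUnitary_apply_mem_evenPart (-τ) x.2⟩
  map_add' x y := by ext1; simp
  map_smul' c x := by ext1; simp
  left_inv x := by
    ext1
    change (scalingUnitary (-τ) * scalingUnitary τ) (x : Lp ℂ 2 (volume : Measure ℝ)) = x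
    rw [scalingUnitary_neg_mul, one_apply_eq_self]
  right_inv x := by
    ext1
    change (scalingUnitary τ * scalingUnitary (-τ)) (x : Lp ℂ 2 (volume : Measure ℝ)) = x
    rw [scalingUnitary_mul_neg, one_apply_eq_self]
  norm_map' x := norm_scalingUnitary_apply τ (x : Lp ℂ 2 (volume : Measure ℝ))

/-- The restriction acts as `ϑ_τ`. [cite: ConnesConsani2021, §4 eq. (40) p. 15] -/
theorem coe_scalingUnitaryEven (τ : ℝ) (x : evenPart) :
    ((scalingUnitaryEven τ x : evenPart) : Lp ℂ 2 (volume : Measure ℝ)) = scalingUnitary τ x := rfl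

/-- Its inverse acts as `ϑ_{−τ}`. [cite: ConnesConsani2021, §4 eq. (40) p. 15] -/
theorem coe_scalingUnitaryEven_symm (τ : ℝ) (x : evenPart) :
    (((scalingUnitaryEven τ).symm x : evenPart) : Lp ℂ 2 (volume : Measure ℝ)) = scalingUnitary (-τ) x := rfl

/-- **Transport of a Hilbert basis of `L²(ℝ)_ev` by `ϑ_{−τ}`**: `(b.scalingConj τ) i = ϑ_{−τ} (b i)`. [cite: Connes1999, §VII Thm 4 (arXiv p0013:L1) (the trace along any orthonormal basis)] -/
def _root_.HilbertBasis.scalingConj {ι : Type*}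
    (b : HilbertBasis ι ℂ (evenPart : Submodule ℂ (Lp ℂ 2 (volume : Measure ℝ)))) (τ : ℝ) :
    HilbertBasis ι ℂ (evenPart : Submodule ℂ (Lp ℂ 2 (volume : Measure ℝ))) :=
  ⟨(scalingUnitaryEven τ).trans b.repr⟩

/-- The transported basis vectors are `ϑ_{−τ} b_i`. [cite: Connes1999, §VII Thm 4 (arXiv p0013:L1)] -/
theorem _root_.HilbertBasis.coe_scalingConj {ι : Type*}
    (b : HilbertBasis ι ℂ (evenPart : Submodule ℂ (Lp ℂ 2 (volume : Measure ℝ)))) (τ : ℝ) (i : ι) :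
    ((b.scalingConj τ i : evenPart) : Lp ℂ 2 (volume : Measure ℝ)) =
      scalingUnitary (-τ) ((b i : evenPart) : Lp ℂ 2 (volume : Measure ℝ)) := by
  classical
  rw [← b.repr_symm_single i, ← (b.scalingConj τ).repr_symm_single i]
  rfl

/-- **Diagonal coefficients are transported**: `⟨b_i, ϑ_τ X ϑ_{−τ} b_i⟩ = ⟨b'_i, X b'_i⟩` with `b' = b.scalingConj τ`
(`ϑ_τ† = ϑ_{−τ}`), for every bounded `X` — so a diagonal series over Hilbert bases of `L²(ℝ)_ev` of a
`ϑ_τ`-conjugate is a diagonal series of `X` over another Hilbert basis of `L²(ℝ)_ev`. [cite: Connes1999, §VII Thm 4 and proof eq. (29) (arXiv p0013)] -/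
theorem inner_conj_scalingUnitary_eq {ι : Type*}
    (b : HilbertBasis ι ℂ (evenPart : Submodule ℂ (Lp ℂ 2 (volume : Measure ℝ)))) (τ : ℝ)
    (X : Lp ℂ 2 (volume : Measure ℝ) →L[ℂ] Lp ℂ 2 (volume : Measure ℝ)) (i : ι) :
    ⟪((b i : evenPart) : Lp ℂ 2 (volume : Measure ℝ)),
        (scalingUnitary τ * X * scalingUnitary (-τ)) ((b i : evenPart) : Lp ℂ 2 (volume : Measure ℝ))⟫_ℂ =
      ⟪((b.scalingConj τ i : evenPart) : Lp ℂ 2 (volume : Measure ℝ)),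
        X ((b.scalingConj τ i : evenPart) : Lp ℂ 2 (volume : Measure ℝ))⟫_ℂ := by
  rw [HilbertBasis.coe_scalingConj, mul_apply_eq_comp, mul_apply_eq_comp, ← ContinuousLinearMap.adjoint_inner_left,
    adjoint_scalingUnitary]

/-- The `diagCoeff` form: `diagCoeff g (ϑ_τ A ϑ_{−τ}) (b i) = diagCoeff g A (b' i)` (`ϑ(g)` commutes with `ϑ_τ`). [cite: Connes1999, §VII Thm 4 and proof eq. (29) (arXiv p0013)] -/
theorem diagCoeff_conj_scalingUnitary {ι : Type*} (g : ℝ → ℂ)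
    (b : HilbertBasis ι ℂ (evenPart : Submodule ℂ (Lp ℂ 2 (volume : Measure ℝ)))) (τ : ℝ)
    (A : Lp ℂ 2 (volume : Measure ℝ) →L[ℂ] Lp ℂ 2 (volume : Measure ℝ)) (i : ι) :
    diagCoeff g (scalingUnitary τ * A * scalingUnitary (-τ)) ((b i : evenPart) : Lp ℂ 2 (volume : Measure ℝ)) =
      diagCoeff g A ((b.scalingConj τ i : evenPart) : Lp ℂ 2 (volume : Measure ℝ)) := by
  rw [diagCoeff, diagCoeff, HilbertBasis.coe_scalingConj, mul_apply_eq_comp, mul_apply_eq_comp]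
  have hc : ∀ y : Lp ℂ 2 (volume : Measure ℝ),
      scalingOp g (scalingUnitary τ y) = scalingUnitary τ (scalingOp g y) := fun y => by
    rw [← mul_apply_eq_comp, ← (commute_scalingUnitary_scalingOp τ g).eq, mul_apply_eq_comp]
  rw [hc, ← ContinuousLinearMap.adjoint_inner_left, adjoint_scalingUnitary]

end Even

/-! ## §3. Hilbert–Schmidt data of `ϑ(g) Q_{a,b}` along Hilbert bases of `L²(ℝ)_ev` -/

section HSData

variable {g : ℝ → ℂ}

/-- **`ϑ(g) Q_{a,b}` is Hilbert–Schmidt along every Hilbert basis of `L²(ℝ)_ev`** (`g ∈ C_c(ℝ)`, `0 < a ≤ b`):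
`Σ_j ‖ϑ(g) Q_{a,b} f_j‖² ≤ ∫∫ |k^Q_g|² < ∞`. [cite: Connes1999, §VII proof of Thm 4 eqs. (30)–(33) (arXiv p0013); ReedSimon1972, Thm. VI.18, VI.23] -/
theorem summable_norm_sq_scalingOp_shellProj_of_mem (hg : Continuous g) (hgs : HasCompactSupport g) {a b : ℝ}
    (ha : 0 < a) (hab : a ≤ b) {ι : Type*}
    (f : HilbertBasis ι ℂ (evenPart : Submodule ℂ (Lp ℂ 2 (volume : Measure ℝ)))) :
    Summable fun j => ‖scalingOp g (shellProj a b ((f j : evenPart) : Lp ℂ 2 (volume : Measure ℝ)))‖ ^ 2 := by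
  haveI : CompleteSpace (evenPart : Submodule ℂ (Lp ℂ 2 (volume : Measure ℝ))) := completeSpace_evenPart
  obtain ⟨w, e, -⟩ := exists_hilbertBasis ℂ (Lp ℂ 2 (volume : Measure ℝ))
  have h := (summable_norm_sq_apply_of_mem_of_summable e f (scalingOp g ∘L shellProj a b)
    (by simpa only [ContinuousLinearMap.comp_apply] using (hasSum_norm_sq_scalingOp_shellProj hg hgs ha hab e).summable)).1
  simpa only [ContinuousLinearMap.comp_apply] using h

/-- **`(ϑ(g) Q_{a,b})†` is Hilbert–Schmidt along every Hilbert basis of `L²(ℝ)_ev`** (the adjoint has the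
same Hilbert–Schmidt sum, Reed–Simon VI.22 (d)). [cite: Connes1999, §VII proof of Thm 4 eqs. (30)–(33) (arXiv p0013); ReedSimon1972, Thm. VI.22 (d), PDF p. 198] -/
theorem summable_norm_sq_adjoint_scalingOp_shellProj_of_mem (hg : Continuous g) (hgs : HasCompactSupport g)
    {a b : ℝ} (ha : 0 < a) (hab : a ≤ b) {ι : Type*}
    (f : HilbertBasis ι ℂ (evenPart : Submodule ℂ (Lp ℂ 2 (volume : Measure ℝ)))) :
    Summable fun j => ‖ContinuousLinearMap.adjoint (scalingOp g ∘L shellProj a b)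
      ((f j : evenPart) : Lp ℂ 2 (volume : Measure ℝ))‖ ^ 2 := by
  haveI : CompleteSpace (evenPart : Submodule ℂ (Lp ℂ 2 (volume : Measure ℝ))) := completeSpace_evenPart
  obtain ⟨w, e, -⟩ := exists_hilbertBasis ℂ (Lp ℂ 2 (volume : Measure ℝ))
  have hT : HasSum (fun i => ‖(scalingOp g ∘L shellProj a b) (e i)‖ ^ 2)
      (∫ v, ∫ y, ‖shellScalingKernel g a b v y‖ ^ 2) := by
    simpa only [ContinuousLinearMap.comp_apply] using hasSum_norm_sq_scalingOp_shellProj hg hgs ha hab e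
  have hadj := ((hasSum_norm_sq_adjoint_iff e e (scalingOp g ∘L shellProj a b)).1 hT).summable
  exact (summable_norm_sq_apply_of_mem_of_summable e f
    (ContinuousLinearMap.adjoint (scalingOp g ∘L shellProj a b)) hadj).1

/-- **The pairing bound for an annulus piece**: for `g₁, g₂ ∈ C_c(ℝ)`, shells `Q = Q_{a,b}`, `Q' = Q_{a',b'}`
(`0 < a ≤ b`, `0 < a' ≤ b'`), any contraction-free bounded `W`, `M ∈ ℝ`, and every Hilbert basis `(f_j)` of
`L²(ℝ)_ev`, the diagonal series of `(ϑ(g₁) Q)·P̂⁰_M·… ` is controlled through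
`|⟨(ϑ(g₁)Q)† f_j, P̂⁰_M (ϑ(g₂) Q') f_j⟩| ≤ ‖(ϑ(g₁)Q)† f_j‖ ‖ϑ(g₂) Q' f_j‖`, whose sum is finite and independent of `M`:
`Σ_j ‖(ϑ(g₁)Q)† f_j‖ ‖ϑ(g₂)Q' f_j‖ < ∞`. [cite: Connes1999, §VII proof of Thm 4 eqs. (30)–(33) (arXiv p0013); ReedSimon1972, Thm. VI.22 (c), (e), PDF p. 198] -/
theorem summable_norm_adjoint_mul_norm_shellProj_of_mem {g₁ g₂ : ℝ → ℂ} (hg₁ : Continuous g₁)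
    (hg₁s : HasCompactSupport g₁) (hg₂ : Continuous g₂) (hg₂s : HasCompactSupport g₂) {a b a' b' : ℝ}
    (ha : 0 < a) (hab : a ≤ b) (ha' : 0 < a') (hab' : a' ≤ b') {ι : Type*}
    (f : HilbertBasis ι ℂ (evenPart : Submodule ℂ (Lp ℂ 2 (volume : Measure ℝ)))) :
    Summable fun j => ‖ContinuousLinearMap.adjoint (scalingOp g₁ ∘L shellProj a b)
        ((f j : evenPart) : Lp ℂ 2 (volume : Measure ℝ))‖ *
      ‖scalingOp g₂ (shellProj a' b' ((f j : evenPart) : Lp ℂ 2 (volume : Measure ℝ)))‖ :=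
  summable_norm_mul_norm_of_sq (summable_norm_sq_adjoint_scalingOp_shellProj_of_mem hg₁ hg₁s ha hab f)
    (summable_norm_sq_scalingOp_shellProj_of_mem hg₂ hg₂s ha' hab' f)

end HSData

end Literature.NumberTheory.Connes2026
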